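import Literature.MathematicalPhysics.QuantumLattice.AnisotropicXYInfraredBound
import Literature.MathematicalPhysics.QuantumLattice.HeisenbergOrderDLSInfrared
import HarnessLib

/-!
# The infrared bound at positive temperature for the quantum XY model with direction-dependent
# couplings (Dyson–Lieb–Simon's bound (44) with Kennedy–Lieb–Shastry's `E^r_q`)

Topic `MathematicalPhysics/QuantumLattice`; the positive-temperature twin of
`AnisotropicXYInfraredBound.lean`, for the Gibbs state of
`H_K = xyAnisoTorus L n K = -Σ_xΣᵢ Kᵢ(S¹_xS¹_{x+eᵢ} + S²_xS²_{x+eᵢ})` (every `d`, every spin `n/2`).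
No named fact is introduced.

## What is printed

Kennedy–Lieb–Shastry, J. Stat. Phys. **53** (1988), p. 1020, on the model (5) with couplings
`1, 1, r`: "the techniques we use may be combined with the techniques of Dyson et al. for nonzero
temperatures to prove the existence of a phase transition"; the techniques of Dyson–Lieb–Simon,
J. Stat. Phys. **18** (1978), are Gaussian domination (Thm. 4.2), the infrared bound for the
Duhamel two-point function (Thm. 4.1, eq. (44): `(Ŝ_p, Ŝ_{-p}) ≤ 1/(2βE_p)`) and the transfer to the
ordinary two-point function (Thms. 3.1–3.2, Falk–Bruch). With the anisotropic Gaussian domination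
`Z_β(H_K(h)) ≤ Z_β(H_K)` (`partitionFn_xyAnisoField_le`) the same chain runs with
`E^K_q = ΣᵢKᵢ(1 - cos qᵢ)` ([KLS1988JSP] eq. (7)) in place of `E_q` and with the DIRECTION-RESOLVED
thermal bond correlations `e_α^{(i)} = |Λ|⁻¹Σ_x Re⟨S^α_xS^α_{x+eᵢ}⟩_β` ([KLS1988JSP] p. 1026, `ρ₁, ρ₃`)
in the double commutator:

`0 ≤ ĝ¹_q ≤ 1/(2βE^K_q) + ½[ΣᵢKᵢ(e₁^{(i)} - e₃^{(i)}cos qᵢ)/E^K_q]^{1/2}`, `q ≠ 0`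
(`xyAniso_infraredBound_thermal`), the isotropic case `K ≡ 1` being the tree's
`xy_infraredBound_thermal` ([KLS1988PRL] eq. (4) at `T > 0`).

## Contents

* `gibbsDirBondCorr β H α i = |Λ|⁻¹Σ_x G^α(x, x+eᵢ)` (direction-resolved thermal bond correlation of
  a torus Hamiltonian) and its sum rule `gibbsStructureFactor_dirSumRule`
  (`|Λ|⁻¹Σ_q ĝ^α_q cos qᵢ = e_α^{(i)}`, [KLS1988JSP] eq. (8));
* `quarterTurn_conj_xyAnisoTorus`, `gibbsState_aniso_corr_one_eq_zero` (the `U(1)` symmetry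
  `G² = G¹` of the Gibbs state of `H_K`);
* `re_gibbsState_aniso_lie_lie(_modes)` — the Gibbs expectation of `[A,[H_K,A]]`
  (`lie_lie_xyAnisoTorus`): `Re⟨[C,[H_K,C]]⟩ + Re⟨[D,[H_K,D]]⟩ = 2|Λ|ΣᵢKᵢ(e₂^{(i)} - cos qᵢ e₃^{(i)})`;
* `xyAniso_infraredBound_thermal_of_gd` ((GDᵀ_K) ⇒ the bound, `L ≥ 3`) and the unconditional
  `xyAniso_infraredBound_thermal` (even `L ≥ 4`, `K > 0`).

## References

* [DLS1978] F. J. Dyson, E. H. Lieb, B. Simon, J. Stat. Phys. 18 (1978) 335–383, Thms. 3.1–3.2,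
  4.1, 4.2, eq. (44) (Lieb Selecta IV.3).
* [KLS1988JSP] T. Kennedy, E. H. Lieb, B. S. Shastry, J. Stat. Phys. 53 (1988) 1019–1030,
  p. 1020, eqs. (5)–(8), p. 1026 (Lieb Selecta IV.7).
* [KLS1988PRL] T. Kennedy, E. H. Lieb, B. S. Shastry, Phys. Rev. Lett. 61 (1988) 2582–2584, eq. (4).
-/

noncomputable section

open Filter Topology Matrix Finset
open Literature.MathematicalPhysics.QuantumLattice Literature.MathematicalPhysics.QuantumLattice.SpinOperators
  Literature.Probability.LatticeModels Literature.Barriers.AtomisticToContinuum.BoseGas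
open scoped ComplexOrder

namespace Literature.MathematicalPhysics.QuantumLattice

variable {d : ℕ}

-- the commutator Lie-ring structure of an associative ring (Mathlib idiom, as in
-- `XYOrderInfraredProofs.lean`)
attribute [local instance 100] LieRing.ofAssociativeRing

/-! ### Direction-resolved thermal bond correlations and their sum rule -/

section DirBond

variable {L : ℕ} [NeZero L] {n : ℕ}

/-- **The direction-resolved thermal nearest-neighbour correlation**
`e_α^{(i)} = |Λ|⁻¹ Σ_x G^α(x, x + eᵢ)` of a torus Hamiltonian `H` (KLS's `ρ₁, ρ₃`: "the expectations
of `𝐒_x·𝐒_y` for bonds `{xy}` in the first and third lattice directions", per spin component; the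
direction average of these is `gibbsBondCorr`). [cite: KLS1988JSP, p. 1026] -/
def gibbsDirBondCorr (β : ℝ) (H : Op (TorusSite d L) (n + 1)) (α : Fin 3) (i : Fin d) : ℝ :=
  (∑ x : TorusSite d L, gibbsSpinCorr β H α x (x + Pi.single i 1)) / (L : ℝ) ^ d

variable (β : ℝ) {H : Op (TorusSite d L) (n + 1)}

/-- **The direction-resolved sum rule** ([KLS1988JSP] eq. (8), one direction at a time):
`|Λ|⁻¹ Σ_q ĝ^α_q cos qᵢ = e_α^{(i)}` for a Hermitian torus Hamiltonian (orthogonality of the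
characters, `sum_structureFactor_mul_cos`). [cite: KLS1988JSP, eq. (8)] -/
theorem gibbsStructureFactor_dirSumRule (hH : H.IsHermitian) (α : Fin 3) (i : Fin d) :
    (∑ q : TorusSite d L, gibbsStructureFactor β H α q * Real.cos (latticeMomentum L q i)) /
        (L : ℝ) ^ d = gibbsDirBondCorr β H α i := by
  have hL0 : (L : ℝ) ^ d ≠ 0 := by
    have : (L : ℝ) ≠ 0 := by exact_mod_cast NeZero.ne L
    positivity
  simp_rw [gibbsStructureFactor, gibbsDirBondCorr, div_mul_eq_mul_div, ← sum_div]
  rw [sum_structureFactor_mul_cos L (gibbsSpinCorr β H α) (gibbsSpinCorr_symm β hH α) i]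
  field_simp

/-- The direction average of the `e_α^{(i)}` is `gibbsBondCorr`. [cite: KLS1988JSP, eq. (3)] -/
theorem sum_gibbsDirBondCorr_div (hd : 0 < d) (α : Fin 3) :
    (∑ i : Fin d, gibbsDirBondCorr β H α i) / d = gibbsBondCorr β H α := by
  have hd' : (d : ℝ) ≠ 0 := by exact_mod_cast hd.ne'
  have hL0 : (L : ℝ) ^ d ≠ 0 := by
    have : (L : ℝ) ≠ 0 := by exact_mod_cast NeZero.ne L
    positivity
  simp_rw [gibbsDirBondCorr, gibbsBondCorr, ← sum_div]
  rw [sum_comm]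
  field_simp

end DirBond

/-! ### The `U(1)` symmetry of the Gibbs state of `H_K` -/

section Symmetry

variable (L : ℕ) [NeZero L] (n : ℕ) (K : Fin d → ℝ)

/-- The global quarter turn about the `3`-axis fixes `H_K` (every bond `S¹S¹ + S²S²` is
invariant). [cite: KLS1988PRL, after eq. (3)] [cite: KLS1988JSP, eq. (5)] -/
theorem quarterTurn_conj_xyAnisoTorus :
    productOp (fun _ : TorusSite d L => diagonal fun k : Fin (n + 1) => (-Complex.I) ^ (k : ℕ)) *
        xyAnisoTorus L n K *
        (productOp (fun _ : TorusSite d L => diagonal fun k : Fin (n + 1) => (-Complex.I) ^ (k : ℕ)))ᴴ =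
      xyAnisoTorus L n K := by
  rw [xyAnisoTorus, xyWeightedHamiltonian, Finset.mul_sum, Finset.sum_mul]
  refine sum_congr rfl fun e _ => ?_
  rw [Matrix.mul_smul, Matrix.smul_mul]
  congr 1
  induction e using Sym2.ind with
  | h x y =>
    simp only [Sym2.lift_mk, xyBond, Matrix.mul_neg, Matrix.neg_mul, Matrix.mul_add,
      Matrix.add_mul, quarterTurn_conj_spinBond_zero, quarterTurn_conj_spinBond_one]
    abel

/-- **(Sᵀ_K)** `⟨S²_xS²_y⟩_β = ⟨S¹_xS¹_y⟩_β` in the Gibbs state of `H_K` (invariance under the global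
quarter turn). [cite: KLS1988PRL, after eq. (3)] [cite: KLS1988JSP, eq. (5)] -/
theorem gibbsState_aniso_corr_one_eq_zero (β : ℝ) (x y : TorusSite d L) :
    gibbsState β (xyAnisoTorus L n K) (siteSpin n x 1 * siteSpin n y 1) =
      gibbsState β (xyAnisoTorus L n K) (siteSpin n x 0 * siteSpin n y 0) := by
  set U : Op (TorusSite d L) (n + 1) :=
    productOp (fun _ : TorusSite d L => diagonal fun k : Fin (n + 1) => (-Complex.I) ^ (k : ℕ))
    with hU
  have hUU : Uᴴ * U = 1 := productOp_conjTranspose_mul fun _ => spinPhase_conjTranspose_mul n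
  have hcomm : U * xyAnisoTorus L n K = xyAnisoTorus L n K * U := by
    have h2 : U * xyAnisoTorus L n K * Uᴴ * U = xyAnisoTorus L n K * U := by
      rw [hU, quarterTurn_conj_xyAnisoTorus]
    rw [mul_assoc, hUU, mul_one] at h2
    exact h2
  have hinv := gibbsState_conj_of_commute hcomm hUU β (siteSpin n x 1 * siteSpin n y 1)
  rw [productOp_conj_mul (fun _ => spinPhase_conjTranspose_mul n),
    quarterTurn_conj_siteSpin_one, quarterTurn_conj_siteSpin_one] at hinv
  rw [hinv]

end Symmetry

/-! ### Gibbs expectations of the double commutator of `H_K` -/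

section DoubleCommutator

variable (β : ℝ) (L : ℕ) [NeZero L] (n : ℕ) (K : Fin d → ℝ)

/-- The Gibbs expectation of the double commutator of `H_K` with a real wave `A = Σ a_xS¹_x`, bond
by bond (`L ≥ 3`; product form `A(HA - AH) - (HA - AH)A = [A,[H,A]]`):
`Re⟨[A,[H_K,A]]⟩_β = Σ_xΣᵢ Kᵢ((a_x² + a_{x+eᵢ}²)G²(x,x+eᵢ) - 2a_xa_{x+eᵢ}G³(x,x+eᵢ))`.
[cite: KLS1988JSP, eq. (13), p. 1026] [cite: DysonLiebSimon1978, Thm. 3.2] -/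
theorem re_gibbsState_aniso_lie_lie (hL3 : 3 ≤ L) (a : TorusSite d L → ℝ) :
    (gibbsState β (xyAnisoTorus L n K)
      ((∑ u : TorusSite d L, (a u : ℂ) • (siteSpin n u 0 : Op (TorusSite d L) (n + 1))) *
          (xyAnisoTorus L n K * (∑ u : TorusSite d L, (a u : ℂ) • (siteSpin n u 0 : Op (TorusSite d L) (n + 1))) -
            (∑ u : TorusSite d L, (a u : ℂ) • (siteSpin n u 0 : Op (TorusSite d L) (n + 1))) *
              xyAnisoTorus L n K) -
        (xyAnisoTorus L n K * (∑ u : TorusSite d L, (a u : ℂ) • (siteSpin n u 0 : Op (TorusSite d L) (n + 1))) -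
            (∑ u : TorusSite d L, (a u : ℂ) • (siteSpin n u 0 : Op (TorusSite d L) (n + 1))) *
              xyAnisoTorus L n K) *
          (∑ u : TorusSite d L, (a u : ℂ) • (siteSpin n u 0 : Op (TorusSite d L) (n + 1))))).re =
      ∑ x : TorusSite d L, ∑ i : Fin d, K i *
        ((a x ^ 2 + a (x + Pi.single i 1) ^ 2) *
            gibbsSpinCorr β (xyAnisoTorus L n K) 1 x (x + Pi.single i 1) -
          2 * a x * a (x + Pi.single i 1) *
            gibbsSpinCorr β (xyAnisoTorus L n K) 2 x (x + Pi.single i 1)) := by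
  show (gibbsState β (xyAnisoTorus L n K)
      ⁅(∑ u : TorusSite d L, (a u : ℂ) • (siteSpin n u 0 : Op (TorusSite d L) (n + 1))),
        ⁅xyAnisoTorus L n K,
          ∑ u : TorusSite d L, (a u : ℂ) • (siteSpin n u 0 : Op (TorusSite d L) (n + 1))⁆⁆).re = _
  rw [lie_lie_xyAnisoTorus L n K hL3, map_sum, Complex.re_sum]
  refine sum_congr rfl fun x _ => ?_
  rw [map_sum, Complex.re_sum]
  refine sum_congr rfl fun i _ => ?_
  rw [LinearMap.map_smul, smul_eq_mul, Complex.re_ofReal_mul, map_sub, LinearMap.map_smul,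
    LinearMap.map_smul, smul_eq_mul, smul_eq_mul, Complex.sub_re,
    show ((a x : ℂ) ^ 2 + (a (x + Pi.single i 1) : ℂ) ^ 2) =
      ((a x ^ 2 + a (x + Pi.single i 1) ^ 2 : ℝ) : ℂ) by push_cast; ring,
    show (2 * (a x : ℂ) * (a (x + Pi.single i 1) : ℂ)) =
      ((2 * a x * a (x + Pi.single i 1) : ℝ) : ℂ) by push_cast; ring,
    Complex.re_ofReal_mul, Complex.re_ofReal_mul]
  rfl

/-- **The two modes together** (`L ≥ 3`):
`Re⟨[C_q,[H_K,C_q]]⟩_β + Re⟨[D_q,[H_K,D_q]]⟩_β = 2ΣᵢKᵢΣ_z(G²(z,z+eᵢ) - cos qᵢ G³(z,z+eᵢ))`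
(product form of the brackets). [cite: KLS1988JSP, eq. (13), p. 1026] [cite: KLS1988PRL, eq. (4)] -/
theorem re_gibbsState_aniso_lie_lie_modes (hL3 : 3 ≤ L) (q : TorusSite d L) :
    (gibbsState β (xyAnisoTorus L n K) (xyCosMode L n q *
        (xyAnisoTorus L n K * xyCosMode L n q - xyCosMode L n q * xyAnisoTorus L n K) -
        (xyAnisoTorus L n K * xyCosMode L n q - xyCosMode L n q * xyAnisoTorus L n K) *
          xyCosMode L n q)).re +
      (gibbsState β (xyAnisoTorus L n K) (xySinMode L n q *
        (xyAnisoTorus L n K * xySinMode L n q - xySinMode L n q * xyAnisoTorus L n K) -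
        (xyAnisoTorus L n K * xySinMode L n q - xySinMode L n q * xyAnisoTorus L n K) *
          xySinMode L n q)).re =
      2 * ∑ i : Fin d, K i * ∑ z : TorusSite d L,
        (gibbsSpinCorr β (xyAnisoTorus L n K) 1 z (z + Pi.single i 1) -
          Real.cos (latticeMomentum L q i) *
            gibbsSpinCorr β (xyAnisoTorus L n K) 2 z (z + Pi.single i 1)) := by
  rw [xyCosMode, xySinMode, re_gibbsState_aniso_lie_lie β L n K hL3,
    re_gibbsState_aniso_lie_lie β L n K hL3, ← sum_add_distrib, mul_sum]
  simp_rw [← sum_add_distrib]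
  rw [sum_comm]
  refine sum_congr rfl fun i _ => ?_
  rw [← mul_assoc, mul_sum]
  refine sum_congr rfl fun z _ => ?_
  have h1 := cos_sq_add_sin_sq_torusPhase L q z
  have h2 := cos_sq_add_sin_sq_torusPhase L q (z + Pi.single i 1)
  have h3 := cos_torusPhase_sub L q z (z + Pi.single i 1)
  rw [sub_add_cancel_left, cos_torusPhase_neg_single] at h3
  set G1 := gibbsSpinCorr β (xyAnisoTorus L n K) 1 z (z + Pi.single i 1)
  set G2 := gibbsSpinCorr β (xyAnisoTorus L n K) 2 z (z + Pi.single i 1)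
  linear_combination (K i * G1) * h1 + (K i * G1) * h2 + (2 * K i * G2) * h3

end DoubleCommutator

/-! ### (GDᵀ_K) ⇒ the anisotropic infrared bound at positive temperature -/

section Infrared

variable (L : ℕ) [NeZero L] (n : ℕ) (K : Fin d → ℝ)

/-- **Thermal Gaussian domination ⇒ the anisotropic infrared bound, in finite volume, every
spin.** For `L ≥ 3`, `β > 0` and a dual momentum `q` with `E^K_q > 0`: if
`Z_β(H_K - V_K(h) + ½Q_K(h)) ≤ Z_β(H_K)` for every real field `h`, then
`0 ≤ ĝ¹_K(q) ≤ 1/(2βE^K_q) + ½[ΣᵢKᵢ(e₁^{(i)} - e₃^{(i)}cos qᵢ)/E^K_q]^{1/2}` for the thermal structure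
factor and the direction-resolved thermal bond correlations of `H_K`.
[cite: DysonLiebSimon1978, Thms. 3.1–3.2, Thm. 4.1, eq. (44)] [cite: KLS1988JSP, eqs. (6)–(7), p. 1026]
[cite: KLS1988PRL, eq. (4)] -/
theorem xyAniso_infraredBound_thermal_of_gd (hL3 : 3 ≤ L) {β : ℝ} (hβ : 0 < β)
    (hGD : ∀ h : TorusSite d L → ℝ,
      (partitionFn β (xyAnisoTorus L n K - xyAnisoGradField L n K h +
        ((xyAnisoFieldEnergy L K h / 2 : ℝ) : ℂ) • (1 : Op (TorusSite d L) (n + 1)))).re ≤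
        (partitionFn β (xyAnisoTorus L n K)).re)
    (q : TorusSite d L) (hq : 0 < NVectorAniso.anisoDispersion K (latticeMomentum L q)) :
    0 ≤ gibbsStructureFactor β (xyAnisoTorus L n K) 0 q ∧
      gibbsStructureFactor β (xyAnisoTorus L n K) 0 q ≤
        1 / (2 * β * NVectorAniso.anisoDispersion K (latticeMomentum L q)) +
          1 / 2 * Real.sqrt ((∑ i : Fin d, K i *
            (gibbsDirBondCorr β (xyAnisoTorus L n K) 0 i -
              gibbsDirBondCorr β (xyAnisoTorus L n K) 2 i * Real.cos (latticeMomentum L q i))) /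
            NVectorAniso.anisoDispersion K (latticeMomentum L q)) := by
  -- notation
  set H : Op (TorusSite d L) (n + 1) := xyAnisoTorus L n K with hH_def
  have hH : H.IsHermitian := xyAnisoTorus_isHermitian L n K
  set E : ℝ := NVectorAniso.anisoDispersion K (latticeMomentum L q) with hE_def
  have hE : 0 < E := hq
  set C : Op (TorusSite d L) (n + 1) := xyCosMode L n q with hC_def
  set D : Op (TorusSite d L) (n + 1) := xySinMode L n q with hD_def
  have hC : C.IsHermitian := xyCosMode_isHermitian L n q
  have hD : D.IsHermitian := xySinMode_isHermitian L n q
  have hLd : 0 < (L : ℝ) ^ d := by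
    have : (0 : ℝ) < L := by exact_mod_cast Nat.pos_of_ne_zero (NeZero.ne L)
    positivity
  haveI : Nonempty (TensorIndex (TorusSite d L) (n + 1)) := ⟨fun _ => 0⟩
  set Sg : ℝ := ∑ i : Fin d, K i * (gibbsDirBondCorr β H 0 i -
    gibbsDirBondCorr β H 2 i * Real.cos (latticeMomentum L q i)) with hSg_def
  -- (1) the Duhamel infrared bound `(V_K(h), V_K(h)) ≤ Q_K(h)/β` from Gaussian domination
  have hDuh : ∀ h : TorusSite d L → ℝ,
      (duhamel β H (xyAnisoGradField L n K h) (xyAnisoGradField L n K h)).re ≤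
        xyAnisoFieldEnergy L K h / β := by
    intro h
    have hVh : (xyAnisoGradField L n K h).IsHermitian := by
      unfold xyAnisoGradField
      refine (isSelfAdjoint_sum _ fun x _ => isSelfAdjoint_sum _ fun i _ => ?_).isHermitian
      refine Matrix.IsHermitian.isSelfAdjoint ?_
      rw [IsHermitian, conjTranspose_smul, Complex.star_def, Complex.conj_ofReal,
        ((siteSpin_isHermitian n x 0).sub (siteSpin_isHermitian n _ 0)).eq]
    refine gaussianDomination_duhamel_le_holds _ β hβ H (xyAnisoGradField L n K h) hH hVh
      (xyAnisoFieldEnergy L K h) (fun t => ?_)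
    have := hGD (t • h)
    rwa [xyAnisoGradField_smul, xyAnisoFieldEnergy_smul] at this
  -- (2) the two modes: `(C,C) + (D,D) ≤ |Λ|/(2βE)`
  set b₀ : ℝ := (L : ℝ) ^ d / (2 * β * E) with hb₀_def
  have hb₀ : 0 ≤ b₀ := by positivity
  have hmode : ∀ {W : Op (TorusSite d L) (n + 1)} {h : TorusSite d L → ℝ},
      xyAnisoGradField L n K h = ((2 * E : ℝ) : ℂ) • W →
        (2 * E) ^ 2 * (duhamel β H W W).re ≤ xyAnisoFieldEnergy L K h / β := by
    intro W h hVh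
    have h1 := hDuh h
    rw [hVh, duhamel_smul_smul, show ((2 * E : ℝ) : ℂ) * ((2 * E : ℝ) : ℂ) =
      (((2 * E) ^ 2 : ℝ) : ℂ) by push_cast; ring, Complex.re_ofReal_mul] at h1
    exact h1
  have hb : (duhamel β H C C).re + (duhamel β H D D).re ≤ b₀ := by
    have h1 := hmode (xyAnisoGradField_cos L n K q)
    have h2 := hmode (xyAnisoGradField_sin L n K q)
    have hQ := xyAnisoFieldEnergy_cos_add_sin L K q
    rw [← hE_def] at hQ
    have hsum : (2 * E) ^ 2 * ((duhamel β H C C).re + (duhamel β H D D).re) ≤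
        2 * E * (L : ℝ) ^ d / β := by
      rw [mul_add, ← hQ, add_div]
      exact add_le_add h1 h2
    rw [hb₀_def, le_div_iff₀ (by positivity)]
    rw [le_div_iff₀ hβ] at hsum
    nlinarith [hsum, hE]
  -- (3) Falk–Bruch for the pair `(C, D)`
  have hA : ∀ k : Fin 2, ((![C, D] : Fin 2 → Op (TorusSite d L) (n + 1)) k).IsHermitian := by
    intro k
    fin_cases k
    · exact hC
    · exact hD
  have hFB := falkBruch_sum_le_of_le hH hβ.le hA (b₀ := b₀)
    (by simpa only [Fin.sum_univ_two, Matrix.cons_val_zero, Matrix.cons_val_one] using hb)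
  simp only [Fin.sum_univ_two, Matrix.cons_val_zero, Matrix.cons_val_one] at hFB
  -- (4) the two sides: `|Λ| ĝ` and the double commutator
  have hlhs : gibbsStructureFactor β H 0 q * (L : ℝ) ^ d =
      (gibbsState β H (C * C)).re + (gibbsState β H (D * D)).re :=
    gibbsStructureFactor_eq_modes β H q
  set c : ℝ := (gibbsState β H (C * (H * C - C * H) - (H * C - C * H) * C)).re +
    (gibbsState β H (D * (H * D - D * H) - (H * D - D * H) * D)).re with hc_def
  have hc0 : 0 ≤ c := add_nonneg (hH.re_gibbsState_doubleComm_nonneg hC hβ.le)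
    (hH.re_gibbsState_doubleComm_nonneg hD hβ.le)
  have hcle : c ≤ (L : ℝ) ^ d * (2 * Sg) := by
    have h1 := re_gibbsState_aniso_lie_lie_modes β L n K hL3 q
    have hS : ∀ z w : TorusSite d L, gibbsSpinCorr β H 1 z w = gibbsSpinCorr β H 0 z w :=
      fun z w => by rw [gibbsSpinCorr, gibbsSpinCorr, hH_def, gibbsState_aniso_corr_one_eq_zero]
    have hdir : 2 * ∑ i : Fin d, K i * ∑ z : TorusSite d L,
        (gibbsSpinCorr β H 1 z (z + Pi.single i 1) -
          Real.cos (latticeMomentum L q i) * gibbsSpinCorr β H 2 z (z + Pi.single i 1)) =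
        (L : ℝ) ^ d * (2 * Sg) := by
      rw [hSg_def, mul_sum, mul_sum, mul_sum]
      refine sum_congr rfl fun i _ => ?_
      simp only [hS]
      rw [sum_sub_distrib, ← mul_sum, gibbsDirBondCorr, gibbsDirBondCorr]
      field_simp
    rw [hdir] at h1
    exact h1.le
  -- (5) positivity of `ĝ`
  have haC : 0 ≤ (gibbsState β H (C * C)).re := re_gibbsState_mul_self_nonneg' β hH hC
  have haD : 0 ≤ (gibbsState β H (D * D)).re := re_gibbsState_mul_self_nonneg' β hH hD
  have hg0 : 0 ≤ gibbsStructureFactor β H 0 q := by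
    have h0 : 0 ≤ gibbsStructureFactor β H 0 q * (L : ℝ) ^ d := by
      rw [hlhs]; exact add_nonneg haC haD
    exact nonneg_of_mul_nonneg_left h0 hLd
  refine ⟨hg0, ?_⟩
  -- (6) assemble: `|Λ|ĝ ≤ b₀ + ½√(βb₀c) ≤ b₀ + ½ |Λ| √(Sg/E)`
  have hsqrt : Real.sqrt (β * b₀ * c) ≤ (L : ℝ) ^ d * Real.sqrt (Sg / E) := by
    have h1 : β * b₀ * c ≤ ((L : ℝ) ^ d) ^ 2 * (Sg / E) := by
      calc β * b₀ * c ≤ β * b₀ * ((L : ℝ) ^ d * (2 * Sg)) :=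
            mul_le_mul_of_nonneg_left hcle (by positivity)
        _ = ((L : ℝ) ^ d) ^ 2 * (Sg / E) := by
            rw [hb₀_def]
            field_simp
    calc Real.sqrt (β * b₀ * c) ≤ Real.sqrt (((L : ℝ) ^ d) ^ 2 * (Sg / E)) := Real.sqrt_le_sqrt h1
      _ = (L : ℝ) ^ d * Real.sqrt (Sg / E) := by
          rw [Real.sqrt_mul (sq_nonneg _), Real.sqrt_sq hLd.le]
  have hmain : gibbsStructureFactor β H 0 q * (L : ℝ) ^ d ≤
      b₀ + 1 / 2 * ((L : ℝ) ^ d * Real.sqrt (Sg / E)) := by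
    rw [hlhs]
    calc (gibbsState β H (C * C)).re + (gibbsState β H (D * D)).re
        ≤ b₀ + 1 / 2 * Real.sqrt (β * b₀ * c) := hFB
      _ ≤ b₀ + 1 / 2 * ((L : ℝ) ^ d * Real.sqrt (Sg / E)) := by gcongr
  have hb₀' : b₀ = (L : ℝ) ^ d * (1 / (2 * β * E)) := by rw [hb₀_def]; ring
  rw [hb₀'] at hmain
  have hfin : gibbsStructureFactor β H 0 q * (L : ℝ) ^ d ≤
      (1 / (2 * β * E) + 1 / 2 * Real.sqrt (Sg / E)) * (L : ℝ) ^ d := by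
    calc gibbsStructureFactor β H 0 q * (L : ℝ) ^ d
        ≤ (L : ℝ) ^ d * (1 / (2 * β * E)) + 1 / 2 * ((L : ℝ) ^ d * Real.sqrt (Sg / E)) := hmain
      _ = (1 / (2 * β * E) + 1 / 2 * Real.sqrt (Sg / E)) * (L : ℝ) ^ d := by ring
  exact le_of_mul_le_mul_right hfin hLd

/-- **The infrared bound at positive temperature for the quantum XY model with direction-dependent
couplings** (the combination announced on [KLS1988JSP] p. 1020: Dyson–Lieb–Simon's (44) with
`E^r_q`): on the even torus `(ℤ/Lℤ)^d` of side `L ≥ 4`, for every spin `n/2`, every `K > 0`,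
`β > 0` and momentum `q ≠ 0`,
`0 ≤ ĝ¹_K(q) ≤ 1/(2βE^K_q) + ½[ΣᵢKᵢ(e₁^{(i)} - e₃^{(i)}cos qᵢ)/E^K_q]^{1/2}`. Unconditional: Gaussian
domination is `partitionFn_xyAnisoField_le`.
[cite: DysonLiebSimon1978, Thms. 3.1–3.2, 4.1, 4.2, eq. (44)] [cite: KLS1988JSP, p. 1020, eqs. (5)–(7)]
[cite: KLS1988PRL, eq. (4)] -/
theorem xyAniso_infraredBound_thermal (hLe : Even L) (hL4 : 4 ≤ L) {K : Fin d → ℝ}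
    (hK : ∀ i, 0 < K i) {β : ℝ} (hβ : 0 < β) (q : TorusSite d L) (hq : q ≠ 0) :
    0 ≤ gibbsStructureFactor β (xyAnisoTorus L n K) 0 q ∧
      gibbsStructureFactor β (xyAnisoTorus L n K) 0 q ≤
        1 / (2 * β * NVectorAniso.anisoDispersion K (latticeMomentum L q)) +
          1 / 2 * Real.sqrt ((∑ i : Fin d, K i *
            (gibbsDirBondCorr β (xyAnisoTorus L n K) 0 i -
              gibbsDirBondCorr β (xyAnisoTorus L n K) 2 i * Real.cos (latticeMomentum L q i))) /
            NVectorAniso.anisoDispersion K (latticeMomentum L q)) := by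
  have hL3 : 3 ≤ L := by omega
  refine xyAniso_infraredBound_thermal_of_gd L n K hL3 hβ (fun h => ?_) q
    (anisoDispersion_latticeMomentum_pos L hK hq)
  have hGD := partitionFn_xyAnisoField_le L n hLe hL4 hβ (fun i => (hK i).le) h
  rwa [xyAnisoFieldHamiltonian_eq L n hL3] at hGD

end Infrared

end Literature.MathematicalPhysics.QuantumLattice
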